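import Mathlib
import HarnessLib
import Literature.Combinatorics.Additive.QuasiPeriodicDecompositions
import Literature.Combinatorics.Additive.QuasiProgressions

/-!
# Grynkiewicz 2009, Lemma 5.6 (a summand that is periodic up to two cosets), continued:
# Case 2 (display (34)), the conclusion (17), and the conclusion `d⊆(C, QP) = 1`

Topic `Literature/Combinatorics/Additive`.  Cell `mm-stpp` (D-0046), seat `mm-stpp-lit` (gen 21–22).
Continuation of `QuasiPeriodicDecompositions.lean` (which has reached the proposal size limit): that file
holds, for Lemma 5.6 of [Grynkiewicz2009] (print Mathematika 55; = arXiv:0710.1041v2 Lemma 4.10), the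
displays (31)–(32) (`Grynkiewicz2009.addStab_add_eq_and_display31`, `Grynkiewicz2009.display32`), the
set-up lemmas (`parts_of_not_isQuasiPeriodic`, `exists_two_cosets_sdiff_periodicPart`,
`exists_row_colour`, `exists_col_colour`, `exists_eq_add_of_mem_sdiff_periodicPart`), the reduction to the
two cases of Proposition 5.5 modulo `H` (`prop55_cases_mod`) and the impossibility of Case 1
(`case_one_false`, display (33)).  This file adds **Case 2** (display (34)): under the Case-2 data the
printed structure is forced — "`|A₁| = |B_{b₁}| = 1`, `|A₂| = |B_{b₂}| = |H| − 1`, and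
`C_{c₁} ∪ C_{c₂} = B_{b₁} + (A₁ ∪ A₂)`", `|H| ≥ 3`, the holes `α, β` and
`(A ∪ {α}) + (B ∪ {β}) = (A + B) ∪ {α + t₁}` (`Grynkiewicz2009.case_two_structure`; gen 22 — the gen-21
theorem `case_two_seventeen`, (17) in Case 2, is now its corollary with unchanged statement), together
with the coset pigeonhole `vadd_subset_add_of_card_lt` (Proposition 2.1 (i) inside a coset) and the
bookkeeping `isPeriodicWith_insert_erase` / `isQuasiPeriodicDecomp_insert_of_insert_erase` /
`isQuasiPeriodicDecomp_insert_compl_of_insert_erase` (a set that is `H`-periodic up to one moved element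
has one-element quasi-periodic supersets of itself and of its complement); the ASSEMBLY
`Grynkiewicz2009.nearly_periodic_structure` (gen 22; over `G ⧸ H`, from `prop55_cases_mod`,
`case_one_false`, `case_two_structure`) and from it BOTH PRINTED CONCLUSIONS of Lemma 5.6:
**`Grynkiewicz2009.seventeen_of_nearly_periodic` — (17) holds** (gen 21; statement unchanged, now a
corollary) and **`Grynkiewicz2009.subsetDist_eq_one_of_nearly_periodic` — `d⊆(C, QP_H) = d⊆(C, QP) = 1`
for all `C ∈ {A, B, A + B, Ā, B̄, \overline{A + B}}`** (gen 22), the "`≥ 1`" half being Lemma 5.4 rolled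
out to the complements (`not_isQuasiPeriodic_compl_right`, `not_isQuasiPeriodic_six`: none of the six sets
is quasi-periodic).  Lemma 5.6 is thereby kernel-checked in full.

PRINT (Lemma 5.6, p. 17): "Let `A` and `B` be nonempty subsets of a finite abelian group `G` with
`|A + B| = |A| + |B|`, `0 ∈ A ∩ B`, `|A|, |B|, d⊆(A + B, P) ≥ 3`, `(A, B)` non-extendible, `⟨A⟩ = G` and `A`
not quasi-periodic.  If `A = A₀ ∪ A₂ ∪ A₁` with `A₀` a nonempty periodic subset with maximal period `H`,
`A₁ ⊆ a₁ + H`, and `A₂ ⊆ a₂ + H`, for some `a_i ∈ G`, then `d⊆(C, QP) = 1` for all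
`C ∈ {A, B, A + B, Ā, B̄, overline{A + B}}` and (17) holds."  Here `d⊆(A + B, P) ≥ 3` is carried in the
unfolded form "every periodic superset of `A + B` has at least three more elements"
(`∀ P ⊇ A + B, P.addStab ≠ {0} → 3 ≤ |P ∖ (A + B)|`; bridge to `subsetDist` of `QuasiProgressions.lean`
via `isPeriodic_iff_addStab_ne`), (17) in the `ℕ` form `|(A ∪ {α}) + (B ∪ {β})| + 1 = |A ∪ {α}| + |B ∪ {β}|`,
`H` (`= H(A₀)`) through the finset `A₀.addStab` (`A₀` is `A'` below), `d⊆(C, 𝒮)` = `subsetDist C 𝒮`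
(`QuasiProgressions.lean`), `QP` = `{P | IsQuasiPeriodic P}`, and `QP_H` (quasi-periodic with quasi-period
`H`, print p. 4) = `{P | ∃ P₁ P₀, IsQuasiPeriodicDecomp H P P₁ P₀ ∧ P₁.Nonempty}`; "for all
`C ∈ {A, B, A + B, Ā, B̄, \overline{A + B}}`" is a `∀` over that six-element `Finset (Finset G)`, the bars
being complements in the finite group.

WHAT THIS FILE IS NOT: not Lemma 5.7 (successor work); no definitions, no named facts.

## References
* D. J. Grynkiewicz, *A step beyond Kemperman's structure theorem*, Mathematika 55 (2009) 67–114,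
  doi:10.1112/S0025579300000966, Lemma 5.4 (print p. 16) and Lemma 5.6 with its proof (print pp. 17–18;
  held `paper:doi-10-1112-s0025579300000966`, read 2026-08-28/29) [cite: Grynkiewicz2009, Lemma 5.6].
-/

namespace Literature.Combinatorics.Additive

open Finset
open scoped Pointwise

variable {G : Type*} [AddCommGroup G] [DecidableEq G]

namespace Grynkiewicz2009

/-! ### Lemma 5.6, Case 2 (display (34)): the structure and (17) -/

/-- **Proposition 2.1 (i) inside a coset**: if `X ⊆ x + H`, `Y ⊆ y + H` and `|X| + |Y| ≥ |H| + 1`, then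
`X + Y = x + y + H` (the pigeonhole behind display (34) and behind "`φ_H(a₂ + b₂) ≠ φ_H(c_i)`" in
Case 2 of Lemma 5.6; `H` carried as a finset). [cite: Grynkiewicz2009, Prop 2.1 (i)] -/
theorem vadd_subset_add_of_card_lt {X Y Hf : Finset G} {H : AddSubgroup G}
    (hHf : ∀ g, g ∈ Hf ↔ g ∈ H) {x y : G} (hX : X ⊆ x +ᵥ Hf) (hY : Y ⊆ y +ᵥ Hf)
    (hcard : #Hf < #X + #Y) : (x + y) +ᵥ Hf ⊆ X + Y := by
  intro z hz
  obtain ⟨h, hh, hzh⟩ := mem_vadd_finset.1 hz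
  set S := X.image (fun x' => z - x') with hS
  have hSc : #S = #X := card_image_of_injective _ (fun u v huv => by simpa using huv)
  have hSsub : S ⊆ y +ᵥ Hf := by
    intro s hs
    obtain ⟨x', hx', rfl⟩ := mem_image.1 hs
    obtain ⟨h', hh', rfl⟩ := mem_vadd_finset.1 (hX hx')
    refine mem_vadd_finset.2 ⟨h - h', (hHf _).2 (H.sub_mem ((hHf h).1 hh) ((hHf h').1 hh')), ?_⟩
    rw [← hzh, vadd_eq_add, vadd_eq_add, vadd_eq_add]; abel
  have hnd : ¬ Disjoint S Y := by
    intro hd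
    have := card_le_card (union_subset hSsub hY)
    rw [card_union_of_disjoint hd, card_vadd_finset, hSc] at this
    omega
  obtain ⟨s, hsS, hsY⟩ := not_disjoint_iff.1 hnd
  obtain ⟨x', hx', rfl⟩ := mem_image.1 hsS
  exact mem_add.2 ⟨x', hx', _, hsY, by abel⟩

/-- **Moving one element into an `H`-hole.**  If `X = P ∪ {x} ∪ S` with `P` `H`-periodic, `x ∉ P ∪ S`,
and `S` is the `H`-periodic set `K` with exactly the element `δ` missing (`S ⊆ K`, `δ ∈ K ∖ S`,
`|S| + 1 = |K|`), then `(X ∖ {x}) ∪ {δ} = P ∪ K` is `H`-periodic — the shape "`|A₁| = 1`,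
`|A₂| = |H| − 1`" forced in Case 2 of Lemma 5.6 (and in Case 1 of Lemma 5.7), which makes `X ∪ {δ}`
and `X̄ ∪ {x}` quasi-periodic with quasi-period `H` (`isQuasiPeriodicDecomp_insert_of_insert_erase`,
`isQuasiPeriodicDecomp_insert_compl_of_insert_erase`). [cite: Grynkiewicz2009, Lemma 5.6 (proof, Case 2)] -/
theorem isPeriodicWith_insert_erase {H : AddSubgroup G} {X P S K : Finset G} {x δ : G}
    (hX : X = P ∪ {x} ∪ S) (hP : IsPeriodicWith H P) (hK : IsPeriodicWith H K)
    (hxP : x ∉ P) (hxS : x ∉ S) (hSK : S ⊆ K) (hδK : δ ∈ K) (hδS : δ ∉ S) (hcard : #S + 1 = #K) :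
    IsPeriodicWith H (insert δ (X.erase x)) := by
  have hSK' : insert δ S = K :=
    eq_of_subset_of_card_le (insert_subset hδK hSK) (by rw [card_insert_of_notMem hδS]; omega)
  have heq : insert δ (X.erase x) = P ∪ K := by
    rw [hX, ← hSK']
    ext y
    simp only [mem_insert, mem_erase, mem_union, mem_singleton]
    constructor
    · rintro (rfl | ⟨hne, hy⟩)
      · exact Or.inr (Or.inl rfl)
      · rcases hy with (hy | rfl) | hy
        · exact Or.inl hy
        · exact absurd rfl hne
        · exact Or.inr (Or.inr hy)
    · rintro (hy | rfl | hy)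
      · exact Or.inr ⟨fun h => hxP (by rwa [h] at hy), Or.inl (Or.inl hy)⟩
      · exact Or.inl rfl
      · exact Or.inr ⟨fun h => hxS (by rwa [h] at hy), Or.inr hy⟩
  rw [heq]
  exact hP.union hK

/-- The one-element superset of a set that is `H`-periodic up to one moved element is quasi-periodic
with quasi-period `H`: `X ∪ {δ} = ((X ∖ {x}) ∪ {δ}) ⊔ {x}` for `x ∈ X`, `δ ∉ X` ("letting `α` be the
`H`-hole in `A₂` …", so that `d⊆(C, QP_H) ≤ 1` in Lemma 5.6). [cite: Grynkiewicz2009, Lemma 5.6 (proof, Case 2)] -/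
theorem isQuasiPeriodicDecomp_insert_of_insert_erase {H : AddSubgroup G} (hH : H ≠ ⊥) {X : Finset G}
    {x δ : G} (hx : x ∈ X) (hδ : δ ∉ X) (hper : IsPeriodicWith H (insert δ (X.erase x))) :
    IsQuasiPeriodicDecomp H (insert δ X) (insert δ (X.erase x)) {x} where
  ne_bot := hH
  disjoint := by
    rw [disjoint_singleton_right, mem_insert, mem_erase, not_or]
    exact ⟨fun h => hδ (by rwa [← h]), fun h => h.1 rfl⟩
  union_eq := by
    ext y
    simp only [mem_union, mem_insert, mem_erase, mem_singleton]
    constructor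
    · rintro ((rfl | ⟨-, hy⟩) | rfl)
      · exact Or.inl rfl
      · exact Or.inr hy
      · exact Or.inr hx
    · rintro (rfl | hy)
      · exact Or.inl (Or.inl rfl)
      · by_cases hyx : y = x
        · exact Or.inr hyx
        · exact Or.inl (Or.inr ⟨hyx, hy⟩)
  periodic := hper
  sub_mem := fun u hu v hv => by
    rw [mem_singleton] at hu hv; rw [hu, hv, sub_self]; exact H.zero_mem

/-- The complement version: for `x ∈ X`, `δ ∉ X` with `(X ∖ {x}) ∪ {δ}` `H`-periodic (finite `G`),
`X̄ ∪ {x} = \overline{(X ∖ {x}) ∪ {δ}} ⊔ {δ}` is a quasi-periodic decomposition with quasi-period `H`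
and nonempty periodic part (it contains `x`) — the complements `Ā, B̄, \overline{A + B}` in the
conclusion `d⊆(C, QP_H) = 1` of Lemma 5.6. [cite: Grynkiewicz2009, Lemma 5.6 (proof, Case 2)] -/
theorem isQuasiPeriodicDecomp_insert_compl_of_insert_erase [Fintype G] {H : AddSubgroup G}
    (hH : H ≠ ⊥) {X : Finset G} {x δ : G} (hx : x ∈ X) (hδ : δ ∉ X)
    (hper : IsPeriodicWith H (insert δ (X.erase x))) :
    IsQuasiPeriodicDecomp H (insert x Xᶜ) (insert δ (X.erase x))ᶜ {δ} ∧
      x ∈ (insert δ (X.erase x))ᶜ := by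
  have hxδ : x ≠ δ := fun h => hδ (by rwa [← h])
  have hxmem : x ∈ (insert δ (X.erase x))ᶜ := by
    rw [mem_compl, mem_insert, mem_erase, not_or]
    exact ⟨hxδ, fun h => h.1 rfl⟩
  refine ⟨⟨hH, ?_, ?_, hper.compl, fun u hu v hv => by
    rw [mem_singleton] at hu hv; rw [hu, hv, sub_self]; exact H.zero_mem⟩, hxmem⟩
  · rw [disjoint_singleton_right, mem_compl, not_not]; exact mem_insert_self δ _
  · ext y
    rw [mem_union, mem_compl, mem_insert, mem_erase, mem_singleton, mem_insert, mem_compl]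
    constructor
    · rintro (h | rfl)
      · by_cases hyx : y = x
        · exact Or.inl hyx
        · exact Or.inr fun hyX => h (Or.inr ⟨hyx, hyX⟩)
      · exact Or.inr hδ
    · rintro (rfl | hyX)
      · exact Or.inl fun h => h.elim hxδ fun h' => h'.1 rfl
      · by_cases hyδ : y = δ
        · exact Or.inr hyδ
        · exact Or.inl fun h => h.elim hyδ fun h' => hyX h'.2

/-- **Lemma 5.6, Case 2 (display (34)): the structure.**  In the situation of Lemma 5.6 (as in
`case_one_false`), suppose the second alternative of Proposition 5.5 holds with `ā = φ_H(a₁)`,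
`b̄ = φ_H(b₁)`: `B ∖ B′` meets exactly the two cosets of `b₁, b₂`, the partially filled cosets of `A + B`
are those of `a₁ + b₁` and `a₁ + b₂` (witnesses `w₁, w₂ ∉ A + B`), and `φ_H(a₂ + b₁) = φ_H(a₁ + b₂)`.
Then, as printed: "Consequently, `|A₁| = |B_{b₁}| = 1`, `|A₂| = |B_{b₂}| = |H| − 1`, and
`C_{c₁} ∪ C_{c₂} = B_{b₁} + (A₁ ∪ A₂)` … Hence, since `d⊆(A + B, P) ≥ 3`, it follows that `|H| ≥ 3`
… Consequently, letting `α` be the `H`-hole in `A₂`, and letting `β` be the `H`-hole in `B_{b₂}`, it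
follows that `|(A ∪ {α}) + (B ∪ {β})| = |A + B| + 1`": with `A₁ = {x₁}`, `B_{b₁} = {t₁}`, the holes
`α ∉ A` (of `a₂ + H`), `β ∉ B` (of `b₂ + H`) and `α + t₁ ∉ A + B` (of the coset of `c₂ = a₁ + b₂`),
`(A ∪ {α}) + (B ∪ {β}) = (A + B) ∪ {α + t₁}`, and each of `A`, `B`, `A + B` is `H`-periodic up to one
moved element: `(A ∖ {x₁}) ∪ {α} = A′ ∪ (a₂ + H)`, `(B ∖ {t₁}) ∪ {β} = B′ ∪ (b₂ + H)`,
`((A + B) ∖ {x₁ + t₁}) ∪ {α + t₁} = C′ ∪ (c₂ + H)` are `H`-periodic (whence (17) and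
`d⊆(C, QP_H) = 1` for the six sets, `case_two_seventeen`, `subsetDist_eq_one_of_nearly_periodic`).
PROOF AS PRINTED: display (34) by pigeonhole in the coset of `a₁ + b₂` (`vadd_subset_add_of_card_lt`);
with (32) and the trivial bounds `|C_{c₁}| ≥ |B_{b₁}|, |A₁|`, `|C_{c₂}| ≥ |A₂|, |B_{b₂}|` everything is
tight: `|C_{c₁}| = |A₁| = |B_{b₁}|`, `|C_{c₂}| = |A₂| = |B_{b₂}|`, `|A₁| + |A₂| = |H|`; `|A₁| ≥ 2` would
give `A + B` the nonzero period `a − a′` ("since `A + B` is aperiodic, equality is possible only if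
`|A₁| = 1`"), so `|A₁| = |B_{b₁}| = 1`, `|A₂| = |B_{b₂}| = |H| − 1`, `C_{c₂} = A₁ + B_{b₂} = A₂ + B_{b₁}`;
`|H| ≥ 3` (else `A + B + H` adds at most two elements); the coset of `a₂ + b₂` is full; and the only new
sum in `(A ∪ {α}) + (B ∪ {β})` is the hole of the coset of `c₂`.  (`H` is carried through the finset
`A′.addStab`; for `ā = φ_H(a₂)` apply it with `A₁`, `A₂` interchanged.)
[cite: Grynkiewicz2009, Lemma 5.6 (proof, Case 2, display (34))] -/
theorem case_two_structure {A A' A₁ A₂ B : Finset G} {H : AddSubgroup G} {a₁ a₂ b₁ b₂ w₁ w₂ : G}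
    (hA : A = A' ∪ A₁ ∪ A₂) (hA'ne : A'.Nonempty) (hH : H ≠ ⊥)
    (hA'H : ∀ g, g ∈ A'.addStab ↔ g ∈ H)
    (hA₁ : ∀ x ∈ A₁, x - a₁ ∈ H) (hA₂ : ∀ x ∈ A₂, x - a₂ ∈ H)
    (hAB : #(A + B) = #A + #B) (haper : (A + B).addStab = {0})
    (hP3 : ∀ P : Finset G, A + B ⊆ P → P.addStab ≠ {0} → 3 ≤ #(P \ (A + B)))
    (hneA : IsNonExtendible A B) (hBne : B.Nonempty) (hAqp : ¬ IsQuasiPeriodic A)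
    -- Case 2 data
    (hb₁ : b₁ ∈ B \ periodicPart H B) (hb₂ : b₂ ∈ B \ periodicPart H B) (hb12 : b₁ - b₂ ∉ H)
    (hB2 : ∀ b ∈ B \ periodicPart H B, b - b₁ ∈ H ∨ b - b₂ ∈ H)
    (hC2 : ∀ c ∈ (A + B) \ periodicPart H (A + B), c - (a₁ + b₁) ∈ H ∨ c - (a₁ + b₂) ∈ H)
    (hw₁ : w₁ ∉ A + B) (hw₁c : w₁ - (a₁ + b₁) ∈ H)
    (hw₂ : w₂ ∉ A + B) (hw₂c : w₂ - (a₁ + b₂) ∈ H)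
    (h21 : (a₂ + b₁) - (a₁ + b₂) ∈ H) :
    ∃ α β x₁ t₁ : G,
      A₁ = {x₁} ∧ cosetTrace H B b₁ = {t₁} ∧ #A₂ + 1 = #A'.addStab ∧
      #(cosetTrace H B b₂) + 1 = #A'.addStab ∧
      (A + B) \ periodicPart H (A + B) = t₁ +ᵥ (A₁ ∪ A₂) ∧ 3 ≤ #A'.addStab ∧
      α ∉ A ∧ α - a₂ ∈ H ∧ β ∉ B ∧ β - b₂ ∈ H ∧ α + t₁ ∉ A + B ∧
      insert α A + insert β B = insert (α + t₁) (A + B) ∧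
      IsPeriodicWith H (insert α (A.erase x₁)) ∧ IsPeriodicWith H (insert β (B.erase t₁)) ∧
      IsPeriodicWith H (insert (α + t₁) ((A + B).erase (x₁ + t₁))) := by
  set Hf := A'.addStab with hHfdef
  have hper : IsPeriodicWith H A' := fun h hh => (mem_addStab hA'ne).1 ((hA'H h).2 hh)
  have h0Hf : (0 : G) ∈ Hf := hA'ne.zero_mem_addStab
  obtain ⟨hne₁, hne₂, hd₁, hd₂, h12, hd₁₂, -, -⟩ :=
    parts_of_not_isQuasiPeriodic hA hA'ne hH hA'H hA₁ hA₂ hAqp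
  obtain ⟨hsubC, h32⟩ := display32 hA hA'ne hH hA'H hA₁ hA₂ hAqp hneA hBne
  rw [← hHfdef] at h32
  set C' := periodicPart H (A + B) with hC'
  set B' := periodicPart H B with hB'
  have hC'per : IsPeriodicWith H C' := isPeriodicWith_periodicPart H (A + B)
  have hB'per : IsPeriodicWith H B' := isPeriodicWith_periodicPart H B
  have hABne : (A + B).Nonempty := by rw [← card_pos, hAB]; have := hBne.card_pos; omega
  have hA'A : A' ⊆ A := by rw [hA, union_assoc]; exact subset_union_left
  have hA₁A : A₁ ⊆ A := by rw [hA, union_assoc, union_comm A₁]; intro x hx; simp [hx]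
  have hA₂A : A₂ ⊆ A := by rw [hA]; intro x hx; simp [hx]
  -- traces
  set T₁ := cosetTrace H B b₁ with hT₁
  set T₂ := cosetTrace H B b₂ with hT₂
  have hT₁sub : T₁ ⊆ B \ B' := cosetTrace_subset_sdiff_periodicPart hb₁
  have hT₂sub : T₂ ⊆ B \ B' := cosetTrace_subset_sdiff_periodicPart hb₂
  have hT₁B : T₁ ⊆ B := fun t ht => (mem_sdiff.1 (hT₁sub ht)).1
  have hT₂B : T₂ ⊆ B := fun t ht => (mem_sdiff.1 (hT₂sub ht)).1
  have hT₁ne : T₁.Nonempty := ⟨b₁, mem_cosetTrace_self (mem_sdiff.1 hb₁).1⟩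
  have hT₂ne : T₂.Nonempty := ⟨b₂, mem_cosetTrace_self (mem_sdiff.1 hb₂).1⟩
  have hT₁₂ : Disjoint T₁ T₂ := by
    rcases cosetTrace_disjoint_or_eq H B b₁ b₂ with h | h
    · exact h
    · exfalso
      have : b₂ ∈ T₁ := by rw [hT₁, h]; exact mem_cosetTrace_self (mem_sdiff.1 hb₂).1
      have := (mem_cosetTrace.1 this).2
      exact hb12 (by have := H.neg_mem this; rwa [neg_sub] at this)
  -- `B ∖ B' = T₁ ∪ T₂`
  have hBdec : B \ B' = T₁ ∪ T₂ := by
    refine Subset.antisymm (fun b hb => ?_) (union_subset hT₁sub hT₂sub)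
    rcases hB2 b hb with h | h
    · exact mem_union_left _ (mem_cosetTrace.2 ⟨(mem_sdiff.1 hb).1, h⟩)
    · exact mem_union_right _ (mem_cosetTrace.2 ⟨(mem_sdiff.1 hb).1, h⟩)
  have hcardB : #B = #B' + #T₁ + #T₂ := by
    have h1 : #(B \ B') + #B' = #B := card_sdiff_add_card_eq_card (periodicPart_subset H B)
    rw [hBdec, card_union_of_disjoint hT₁₂] at h1
    omega
  have hcardA : #A = #A' + #A₁ + #A₂ := by
    rw [hA, card_union_of_disjoint, card_union_of_disjoint hd₁]
    exact disjoint_union_left.2 ⟨hd₂, hd₁₂⟩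
  -- cosets as finsets
  have hA₁cos : A₁ ⊆ a₁ +ᵥ Hf := fun x hx =>
    mem_vadd_finset.2 ⟨x - a₁, (hA'H _).2 (hA₁ x hx), by rw [vadd_eq_add, add_sub_cancel]⟩
  have hA₂cos : A₂ ⊆ a₂ +ᵥ Hf := fun x hx =>
    mem_vadd_finset.2 ⟨x - a₂, (hA'H _).2 (hA₂ x hx), by rw [vadd_eq_add, add_sub_cancel]⟩
  have hT₁cos : T₁ ⊆ b₁ +ᵥ Hf := cosetTrace_subset_vadd hA'H B b₁
  have hT₂cos : T₂ ⊆ b₂ +ᵥ Hf := cosetTrace_subset_vadd hA'H B b₂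
  -- `|B + H| ≥ |B'| + 2|H|`
  have hBH : #B' + #Hf + #Hf ≤ #(B + Hf) := by
    have hB'sub : B' ⊆ B + Hf := (periodicPart_subset H B).trans (subset_add_left B h0Hf)
    have hb₁sub : b₁ +ᵥ Hf ⊆ B + Hf := fun y hy => by
      obtain ⟨h, hh, rfl⟩ := mem_vadd_finset.1 hy
      exact add_mem_add (mem_sdiff.1 hb₁).1 hh
    have hb₂sub : b₂ +ᵥ Hf ⊆ B + Hf := fun y hy => by
      obtain ⟨h, hh, rfl⟩ := mem_vadd_finset.1 hy
      exact add_mem_add (mem_sdiff.1 hb₂).1 hh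
    have hB'cos : ∀ {b h : G}, b ∈ B \ B' → h ∈ Hf → b + h ∉ B' := by
      intro b h hb hh hbh
      apply (mem_sdiff.1 hb).2
      have hneg : -h ∈ H := H.neg_mem ((hA'H h).1 hh)
      rw [← hB'per (-h) hneg]
      exact mem_vadd_finset.2 ⟨b + h, hbh, by rw [vadd_eq_add]; abel⟩
    have d1 : Disjoint B' (b₁ +ᵥ Hf) := by
      rw [disjoint_right]; intro y hy
      obtain ⟨h, hh, rfl⟩ := mem_vadd_finset.1 hy
      exact hB'cos hb₁ hh
    have d2 : Disjoint B' (b₂ +ᵥ Hf) := by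
      rw [disjoint_right]; intro y hy
      obtain ⟨h, hh, rfl⟩ := mem_vadd_finset.1 hy
      exact hB'cos hb₂ hh
    have d4 : Disjoint (b₁ +ᵥ Hf) (b₂ +ᵥ Hf) := by
      rw [disjoint_left]; intro y h1 h2
      obtain ⟨h, hh, rfl⟩ := mem_vadd_finset.1 h1
      obtain ⟨h', hh', he⟩ := mem_vadd_finset.1 h2
      apply hb12
      have e : b₁ - b₂ = h' - h := by
        rw [vadd_eq_add, vadd_eq_add] at he
        rw [sub_eq_sub_iff_add_eq_add, add_comm h' b₂]
        exact he.symm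
      rw [e]; exact H.sub_mem ((hA'H h').1 hh') ((hA'H h).1 hh)
    have hU : B' ∪ (b₁ +ᵥ Hf) ∪ (b₂ +ᵥ Hf) ⊆ B + Hf :=
      union_subset (union_subset hB'sub hb₁sub) hb₂sub
    have := card_le_card hU
    rw [card_union_of_disjoint (disjoint_union_left.2 ⟨d2, d4⟩), card_union_of_disjoint d1,
      card_vadd_finset, card_vadd_finset] at this
    exact this
  -- the two colour classes
  set c₁ := a₁ + b₁ with hc₁
  set c₂ := a₁ + b₂ with hc₂
  have hc12 : c₁ - c₂ ∉ H := by
    intro h; apply hb12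
    have e : b₁ - b₂ = c₁ - c₂ := by rw [hc₁, hc₂]; abel
    rw [e]; exact h
  set D := (A + B) \ C' with hD
  set C₁ := D.filter (fun y => y - c₁ ∈ Hf) with hC₁
  set C₂ := D.filter (fun y => y - c₂ ∈ Hf) with hC₂
  have hC₁₂ : Disjoint C₁ C₂ := by
    rw [disjoint_left]; intro y h1 h2
    rw [hC₁, mem_filter] at h1
    rw [hC₂, mem_filter] at h2
    apply hc12
    have e : c₁ - c₂ = (y - c₂) - (y - c₁) := by abel
    rw [e]; exact H.sub_mem ((hA'H _).1 h2.2) ((hA'H _).1 h1.2)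
  have hDdec : D = C₁ ∪ C₂ := by
    refine Subset.antisymm (fun y hy => ?_) (union_subset (filter_subset _ _) (filter_subset _ _))
    rcases hC2 y hy with h | h
    · exact mem_union_left _ (mem_filter.2 ⟨hy, (hA'H _).2 h⟩)
    · exact mem_union_right _ (mem_filter.2 ⟨hy, (hA'H _).2 h⟩)
  have hcardD : #D = #C₁ + #C₂ := by rw [hDdec, card_union_of_disjoint hC₁₂]
  -- no element of the cosets of `c₁`, `c₂` lies in `C'`
  have hnotC : ∀ {w c y : G}, w ∉ A + B → w - c ∈ H → y - c ∈ H → y ∉ C' := by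
    intro w c y hw hwc hyc hyC
    apply hw
    have := (mem_periodicPart.1 hyC).2 (w - y) (by
      have e : w - y = (w - c) - (y - c) := by abel
      rw [e]; exact H.sub_mem hwc hyc)
    rwa [sub_add_cancel] at this
  -- blocks inside the colour classes
  have hblk : ∀ {X Y : Finset G} {x y c w : G}, X ⊆ A → Y ⊆ B → (∀ u ∈ X, u - x ∈ H) →
      (∀ v ∈ Y, v - y ∈ H) → (x + y) - c ∈ H → w ∉ A + B → w - c ∈ H →
      X + Y ⊆ D.filter (fun z => z - c ∈ Hf) := by
    intro X Y x y c w hXA hYB hX hY hxy hw hwc z hz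
    obtain ⟨u, hu, v, hv, rfl⟩ := mem_add.1 hz
    have hzc : u + v - c ∈ H := by
      have e : u + v - c = (u - x) + (v - y) + ((x + y) - c) := by abel
      rw [e]; exact H.add_mem (H.add_mem (hX u hu) (hY v hv)) hxy
    refine mem_filter.2 ⟨mem_sdiff.2 ⟨add_mem_add (hXA hu) (hYB hv), hnotC hw hwc hzc⟩,
      (hA'H _).2 hzc⟩
  have hT₁c : ∀ v ∈ T₁, v - b₁ ∈ H := fun v hv => (mem_cosetTrace.1 hv).2
  have hT₂c : ∀ v ∈ T₂, v - b₂ ∈ H := fun v hv => (mem_cosetTrace.1 hv).2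
  have h11 : A₁ + T₁ ⊆ C₁ :=
    hblk hA₁A hT₁B hA₁ hT₁c (by rw [hc₁, sub_self]; exact H.zero_mem) hw₁ hw₁c
  have h12' : A₁ + T₂ ⊆ C₂ :=
    hblk hA₁A hT₂B hA₁ hT₂c (by rw [hc₂, sub_self]; exact H.zero_mem) hw₂ hw₂c
  have h21' : A₂ + T₁ ⊆ C₂ := hblk hA₂A hT₁B hA₂ hT₁c h21 hw₂ hw₂c
  -- colour classes sit in cosets
  have hC₁cos : C₁ ⊆ c₁ +ᵥ Hf := fun y hy =>
    mem_vadd_finset.2 ⟨y - c₁, (mem_filter.1 hy).2, by rw [vadd_eq_add, add_sub_cancel]⟩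
  have hC₂cos : C₂ ⊆ c₂ +ᵥ Hf := fun y hy =>
    mem_vadd_finset.2 ⟨y - c₂, (mem_filter.1 hy).2, by rw [vadd_eq_add, add_sub_cancel]⟩
  -- display (34): pigeonhole in the coset of `c₂`
  have hw₂C₂ : w₂ ∉ C₂ := fun h => hw₂ (mem_sdiff.1 (mem_filter.1 h).1).1
  have hw₂cos : w₂ ∈ c₂ +ᵥ Hf :=
    mem_vadd_finset.2 ⟨w₂ - c₂, (hA'H _).2 hw₂c, by rw [vadd_eq_add, add_sub_cancel]⟩
  have h34a : #A₁ + #T₂ ≤ #Hf := by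
    by_contra hlt
    have := vadd_subset_add_of_card_lt hA'H hA₁cos hT₂cos (by omega)
    exact hw₂C₂ (h12' (this (by rw [← hc₂]; exact hw₂cos)))
  have h34b : #A₂ + #T₁ ≤ #Hf := by
    by_contra hlt
    have hsub := vadd_subset_add_of_card_lt hA'H hA₂cos hT₁cos (by omega)
    have : w₂ ∈ (a₂ + b₁) +ᵥ Hf := by
      refine mem_vadd_finset.2 ⟨w₂ - (a₂ + b₁), (hA'H _).2 ?_, by rw [vadd_eq_add, add_sub_cancel]⟩
      have e : w₂ - (a₂ + b₁) = (w₂ - c₂) - ((a₂ + b₁) - c₂) := by abel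
      rw [e]; exact H.sub_mem hw₂c h21
    exact hw₂C₂ (h21' (hsub this))
  -- trivial lower bounds
  obtain ⟨x₁, hx₁⟩ := hne₁
  obtain ⟨t₁, ht₁⟩ := hT₁ne
  have hlb1 : #T₁ ≤ #C₁ := by
    have : x₁ +ᵥ T₁ ⊆ C₁ := fun y hy => by
      obtain ⟨t, ht, rfl⟩ := mem_vadd_finset.1 hy
      exact h11 (add_mem_add hx₁ ht)
    have := card_le_card this; rwa [card_vadd_finset] at this
  have hlb2 : #A₂ ≤ #C₂ := by
    have : t₁ +ᵥ A₂ ⊆ C₂ := fun y hy => by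
      obtain ⟨x, hx, rfl⟩ := mem_vadd_finset.1 hy
      rw [vadd_eq_add, add_comm]; exact h21' (add_mem_add hx ht₁)
    have := card_le_card this; rwa [card_vadd_finset] at this
  have hlb3 : #A₁ ≤ #C₁ := by
    have : t₁ +ᵥ A₁ ⊆ C₁ := fun y hy => by
      obtain ⟨x, hx, rfl⟩ := mem_vadd_finset.1 hy
      rw [vadd_eq_add, add_comm]; exact h11 (add_mem_add hx ht₁)
    have := card_le_card this; rwa [card_vadd_finset] at this
  have hlb4 : #T₂ ≤ #C₂ := by
    have : x₁ +ᵥ T₂ ⊆ C₂ := fun y hy => by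
      obtain ⟨t, ht, rfl⟩ := mem_vadd_finset.1 hy
      exact h12' (add_mem_add hx₁ ht)
    have := card_le_card this; rwa [card_vadd_finset] at this
  -- the count: `#C₁ + #C₂ + #Hf ≤ #A₁ + #A₂ + #T₁ + #T₂`
  have hmain : #C₁ + #C₂ + #Hf ≤ #A₁ + #A₂ + #T₁ + #T₂ := by
    rw [hcardD] at h32; omega
  have hcC₁ : #C₁ = #T₁ := by omega
  have hcA₁ : #A₁ = #T₁ := by omega
  have hcC₂ : #C₂ = #A₂ := by omega
  have hcT₂ : #T₂ = #A₂ := by omega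
  have hsum : #A₁ + #A₂ = #Hf := by omega
  -- `C₁ = x + T₁` for every `x ∈ A₁`, `C₂ = x + T₂`
  have hC₁eq : ∀ x ∈ A₁, x +ᵥ T₁ = C₁ := fun x hx =>
    eq_of_subset_of_card_le (fun y hy => by
      obtain ⟨t, ht, rfl⟩ := mem_vadd_finset.1 hy; exact h11 (add_mem_add hx ht))
      (by rw [card_vadd_finset]; omega)
  have hC₂eq : ∀ x ∈ A₁, x +ᵥ T₂ = C₂ := fun x hx =>
    eq_of_subset_of_card_le (fun y hy => by
      obtain ⟨t, ht, rfl⟩ := mem_vadd_finset.1 hy; exact h12' (add_mem_add hx ht))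
      (by rw [card_vadd_finset]; omega)
  have hABdec : A + B = C' ∪ (C₁ ∪ C₂) := by
    rw [← hDdec, hD, union_sdiff_of_subset (periodicPart_subset H (A + B))]
  -- `|A₁| = 1`: otherwise `A + B` has a nonzero period
  have hA₁one : #A₁ = 1 := by
    by_contra hne1
    have h2 : 1 < #A₁ := by have := card_pos.2 ⟨x₁, hx₁⟩; omega
    obtain ⟨x, hx, x', hx', hxx⟩ := one_lt_card.1 h2
    have hdH : x - x' ∈ H := by
      have := H.sub_mem (hA₁ x hx) (hA₁ x' hx'); rwa [sub_sub_sub_cancel_right] at this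
    have hper₁ : (x - x') +ᵥ C₁ = C₁ :=
      calc (x - x') +ᵥ C₁ = (x - x') +ᵥ (x' +ᵥ T₁) := by rw [hC₁eq x' hx']
        _ = x +ᵥ T₁ := by rw [vadd_vadd, sub_add_cancel]
        _ = C₁ := hC₁eq x hx
    have hper₂ : (x - x') +ᵥ C₂ = C₂ :=
      calc (x - x') +ᵥ C₂ = (x - x') +ᵥ (x' +ᵥ T₂) := by rw [hC₂eq x' hx']
        _ = x +ᵥ T₂ := by rw [vadd_vadd, sub_add_cancel]
        _ = C₂ := hC₂eq x hx
    have hperAB : (x - x') +ᵥ (A + B) = A + B := by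
      rw [hABdec, vadd_finset_union, vadd_finset_union, hC'per _ hdH, hper₁, hper₂]
    have : x - x' ∈ (A + B).addStab := (mem_addStab hABne).2 hperAB
    rw [haper, mem_singleton, sub_eq_zero] at this
    exact hxx this
  have hA₁eq : A₁ = {x₁} := by
    obtain ⟨y, hy⟩ := card_eq_one.1 hA₁one
    rw [hy] at hx₁; rw [hy, mem_singleton.1 hx₁]
  have hT₁one : #T₁ = 1 := by omega
  have hT₁eq : T₁ = {t₁} := by
    obtain ⟨y, hy⟩ := card_eq_one.1 hT₁one
    rw [hy] at ht₁; rw [hy, mem_singleton.1 ht₁]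
  have hA₂card : #A₂ + 1 = #Hf := by omega
  have hT₂card : #T₂ + 1 = #Hf := by omega
  -- `|H| ≥ 3`
  have hHf3 : 3 ≤ #Hf := by
    by_contra hlt
    -- `P := (A + B) + Hf` adds at most `(#Hf - #C₁) + (#Hf - #C₂) ≤ 2` elements
    set P := (A + B) + Hf with hP
    have hABP : A + B ⊆ P := subset_add_left _ h0Hf
    obtain ⟨g, hgH, hg0⟩ : ∃ g ∈ H, g ≠ (0 : G) := by
      by_contra hne
      push Not at hne
      exact hH ((AddSubgroup.eq_bot_iff_forall _).2 hne)
    have hPst : P.addStab ≠ {0} := by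
      intro heq
      have : g ∈ P.addStab := by
        rw [mem_addStab (hABne.mono hABP), hP, add_comm (A + B) Hf, ← vadd_add_assoc,
          vadd_addStab ((hA'H g).2 hgH)]
      rw [heq, mem_singleton] at this
      exact hg0 this
    have h3 := hP3 P hABP hPst
    have hC'Hf : C' + Hf = C' := by
      refine Subset.antisymm (fun y hy => ?_) (subset_add_left C' h0Hf)
      obtain ⟨c, hc, k, hk, rfl⟩ := mem_add.1 hy
      rw [← hC'per k ((hA'H k).1 hk), add_comm]
      exact mem_vadd_finset.2 ⟨c, hc, rfl⟩
    have hcos : ∀ {X : Finset G} {c : G}, X ⊆ c +ᵥ Hf → X + Hf ⊆ c +ᵥ Hf := by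
      intro X c hXc y hy
      obtain ⟨x, hx, k, hk, rfl⟩ := mem_add.1 hy
      obtain ⟨h, hh, rfl⟩ := mem_vadd_finset.1 (hXc hx)
      refine mem_vadd_finset.2 ⟨h + k, ?_, by rw [vadd_eq_add, vadd_eq_add, add_assoc]⟩
      exact (hA'H _).2 (H.add_mem ((hA'H h).1 hh) ((hA'H k).1 hk))
    have hPsub : P \ (A + B) ⊆ ((c₁ +ᵥ Hf) \ C₁) ∪ ((c₂ +ᵥ Hf) \ C₂) := by
      intro y hy
      rw [mem_sdiff, hP, hABdec, union_add, union_add, hC'Hf] at hy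
      obtain ⟨hyP, hyAB⟩ := hy
      simp only [mem_union, not_or] at hyP hyAB
      rcases hyP with hyC | hy1 | hy2
      · exact absurd hyC hyAB.1
      · exact mem_union_left _ (mem_sdiff.2 ⟨hcos hC₁cos hy1, hyAB.2.1⟩)
      · exact mem_union_right _ (mem_sdiff.2 ⟨hcos hC₂cos hy2, hyAB.2.2⟩)
    have e1 : #((c₁ +ᵥ Hf) \ C₁) = #Hf - #C₁ := by
      rw [card_sdiff_of_subset hC₁cos, card_vadd_finset]
    have e2 : #((c₂ +ᵥ Hf) \ C₂) = #Hf - #C₂ := by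
      rw [card_sdiff_of_subset hC₂cos, card_vadd_finset]
    have := (card_le_card hPsub).trans (card_union_le _ _)
    rw [e1, e2] at this
    have hp1 : 1 ≤ #C₁ := by omega
    omega
  -- the holes `α` of `A₂` and `β` of `T₂`
  have hα : ∃ α ∈ a₂ +ᵥ Hf, α ∉ A₂ := by
    by_contra hno
    push Not at hno
    have := card_le_card (show a₂ +ᵥ Hf ⊆ A₂ from hno)
    rw [card_vadd_finset] at this; omega
  have hβ : ∃ β ∈ b₂ +ᵥ Hf, β ∉ T₂ := by
    by_contra hno
    push Not at hno
    have := card_le_card (show b₂ +ᵥ Hf ⊆ T₂ from hno)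
    rw [card_vadd_finset] at this; omega
  obtain ⟨α, hαcos, hαA₂⟩ := hα
  obtain ⟨β, hβcos, hβT₂⟩ := hβ
  obtain ⟨gα, hgα, rfl⟩ := mem_vadd_finset.1 hαcos
  obtain ⟨gβ, hgβ, rfl⟩ := mem_vadd_finset.1 hβcos
  have hgαH : gα ∈ H := (hA'H _).1 hgα
  have hgβH : gβ ∈ H := (hA'H _).1 hgβ
  -- `α ∉ A`, `β ∉ B`
  have hαA : (a₂ +ᵥ gα) ∉ A := by
    intro h
    rw [hA, union_assoc, mem_union, mem_union] at h
    rcases h with h | h | h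
    · -- then `A₂ ⊆ A'`
      obtain ⟨x₂, hx₂⟩ := hne₂
      have : x₂ ∈ A' := by
        have hx₂α : x₂ - (a₂ +ᵥ gα) ∈ H := by
          rw [vadd_eq_add]
          have e : x₂ - (a₂ + gα) = (x₂ - a₂) - gα := by abel
          rw [e]; exact H.sub_mem (hA₂ x₂ hx₂) hgαH
        rw [← hper _ hx₂α]
        exact mem_vadd_finset.2 ⟨_, h, by rw [vadd_eq_add, sub_add_cancel]⟩
      exact disjoint_left.1 hd₂ this hx₂
    · apply h12
      have := hA₁ _ h
      rw [vadd_eq_add] at this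
      have e : a₁ - a₂ = gα - (a₂ + gα - a₁) := by abel
      rw [e]; exact H.sub_mem hgαH this
    · exact hαA₂ h
  have hβB : (b₂ +ᵥ gβ) ∉ B := by
    intro h
    apply hβT₂
    rw [hT₂, mem_cosetTrace, vadd_eq_add, add_sub_cancel_left]
    exact ⟨h, hgβH⟩
  -- the coset of `a₂ + b₂` is full
  have hfull22 : (a₂ + b₂) +ᵥ Hf ⊆ A₂ + T₂ :=
    vadd_subset_add_of_card_lt hA'H hA₂cos hT₂cos (by omega)
  have hA₂T₂AB : A₂ + T₂ ⊆ A + B := add_subset_add hA₂A hT₂B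
  -- the new sumset and its single new element `γ`
  set γ := (a₂ +ᵥ gα) + t₁ with hγ
  have hC₂' : t₁ +ᵥ A₂ = C₂ := eq_of_subset_of_card_le (fun y hy => by
      obtain ⟨x, hx, rfl⟩ := mem_vadd_finset.1 hy
      rw [vadd_eq_add, add_comm]; exact h21' (add_mem_add hx ht₁))
    (by rw [card_vadd_finset]; omega)
  have hone : #((c₂ +ᵥ Hf) \ C₂) = 1 := by
    rw [card_sdiff_of_subset hC₂cos, card_vadd_finset]; omega
  have hγc : γ - c₂ ∈ H := by
    have e : γ - c₂ = gα + (t₁ - b₁) + ((a₂ + b₁) - c₂) := by rw [hγ, vadd_eq_add]; abel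
    rw [e]; exact H.add_mem (H.add_mem hgαH (hT₁c t₁ ht₁)) h21
  have hγC₂ : γ ∉ C₂ := by
    intro hγC
    rw [← hC₂'] at hγC
    obtain ⟨x, hx, hxe⟩ := mem_vadd_finset.1 hγC
    apply hαA₂
    have : x = a₂ +ᵥ gα := by
      rw [hγ, vadd_eq_add] at hxe
      rw [add_comm t₁ x] at hxe
      exact add_right_cancel hxe
    rw [← this]; exact hx
  have hγmem : γ ∈ (c₂ +ᵥ Hf) \ C₂ :=
    mem_sdiff.2 ⟨mem_vadd_finset.2 ⟨γ - c₂, (hA'H _).2 hγc, by rw [vadd_eq_add, add_sub_cancel]⟩, hγC₂⟩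
  have hγAB : γ ∉ A + B := by
    intro h
    have hγD : γ ∈ D := mem_sdiff.2 ⟨h, hnotC hw₂ hw₂c hγc⟩
    rw [hDdec, mem_union] at hγD
    rcases hγD with h1 | h2
    · apply hc12
      have e : c₁ - c₂ = (γ - c₂) - (γ - c₁) := by abel
      rw [e]; exact H.sub_mem hγc ((hA'H _).1 (mem_filter.1 h1).2)
    · exact hγC₂ h2
  have hsub : insert (a₂ +ᵥ gα) A + insert (b₂ +ᵥ gβ) B ⊆ insert γ (A + B) := by
    intro z hz
    obtain ⟨u, hu, v, hv, rfl⟩ := mem_add.1 hz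
    rw [mem_insert] at hu hv
    rcases hu with rfl | hu <;> rcases hv with rfl | hv
    · -- α + β ∈ full coset of a₂ + b₂
      refine mem_insert_of_mem (hA₂T₂AB (hfull22 (mem_vadd_finset.2 ⟨gα + gβ,
        (hA'H _).2 (H.add_mem hgαH hgβH), ?_⟩)))
      rw [vadd_eq_add, vadd_eq_add, vadd_eq_add]; abel
    · -- α + v, v ∈ B = B' ∪ T₁ ∪ T₂
      have hvB : v ∈ B' ∪ (T₁ ∪ T₂) := by
        rw [← hBdec, union_sdiff_of_subset (periodicPart_subset H B)]; exact hv
      rw [mem_union, mem_union] at hvB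
      rcases hvB with hv' | hv1 | hv2
      · -- B' is H-periodic: α + v = x₂ + ((α - x₂) + v) with (α - x₂) + v ∈ B
        obtain ⟨x₂, hx₂⟩ := hne₂
        refine mem_insert_of_mem ?_
        have hk : (a₂ +ᵥ gα) - x₂ ∈ H := by
          rw [vadd_eq_add]
          have e : a₂ + gα - x₂ = gα - (x₂ - a₂) := by abel
          rw [e]; exact H.sub_mem hgαH (hA₂ x₂ hx₂)
        have hv'' : ((a₂ +ᵥ gα) - x₂) + v ∈ B := (mem_periodicPart.1 hv').2 _ hk
        have e : (a₂ +ᵥ gα) + v = x₂ + (((a₂ +ᵥ gα) - x₂) + v) := by abel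
        rw [e]; exact add_mem_add (hA₂A hx₂) hv''
      · -- v = t₁: the new element γ
        rw [hT₁eq, mem_singleton] at hv1
        rw [hv1]; exact mem_insert_self _ _
      · -- α + v in the full coset
        refine mem_insert_of_mem (hA₂T₂AB (hfull22 (mem_vadd_finset.2 ⟨gα + (v - b₂),
          (hA'H _).2 (H.add_mem hgαH (hT₂c v hv2)), ?_⟩)))
        rw [vadd_eq_add, vadd_eq_add]; abel
    · -- u + β, u ∈ A = A' ∪ A₁ ∪ A₂
      rw [hA, union_assoc, mem_union, mem_union] at hu
      rcases hu with hu' | hu1 | hu2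
      · -- A' H-periodic: u + β = (u + gβ) + b₂
        refine mem_insert_of_mem ?_
        have : u + gβ ∈ A' := by
          rw [← hper gβ hgβH, add_comm]; exact mem_vadd_finset.2 ⟨u, hu', rfl⟩
        have e : u + (b₂ +ᵥ gβ) = (u + gβ) + b₂ := by rw [vadd_eq_add]; abel
        rw [e]; exact add_mem_add (hA'A this) (mem_sdiff.1 hb₂).1
      · -- u = x₁: x₁ + β is the hole of the coset of c₂, which is γ
        rw [hA₁eq, mem_singleton] at hu1
        subst hu1
        -- both `γ` and `u + β` lie in `(c₂ + Hf) ∖ C₂`, which has one element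
        have huβ : u + (b₂ +ᵥ gβ) ∈ (c₂ +ᵥ Hf) \ C₂ := by
          refine mem_sdiff.2 ⟨mem_vadd_finset.2 ⟨u + (b₂ +ᵥ gβ) - c₂, (hA'H _).2 ?_, by
            rw [vadd_eq_add, add_sub_cancel]⟩, fun hC => ?_⟩
          · have e : u + (b₂ +ᵥ gβ) - c₂ = (u - a₁) + gβ := by rw [hc₂, vadd_eq_add]; abel
            rw [e]; exact H.add_mem (hA₁ u hx₁) hgβH
          · rw [← hC₂eq u hx₁] at hC
            obtain ⟨t, ht, hte⟩ := mem_vadd_finset.1 hC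
            apply hβT₂
            have : t = b₂ +ᵥ gβ := by rw [vadd_eq_add] at hte; exact add_left_cancel hte
            rw [← this]; exact ht
        obtain ⟨z, hz⟩ := card_eq_one.1 hone
        have hγmem' := hγmem
        rw [hz, mem_singleton] at hγmem' huβ
        exact mem_insert.2 (Or.inl (by rw [huβ, hγmem']))
      · -- u ∈ A₂: u + β in the full coset
        refine mem_insert_of_mem (hA₂T₂AB (hfull22 (mem_vadd_finset.2 ⟨(u - a₂) + gβ,
          (hA'H _).2 (H.add_mem (hA₂ u hu2) hgβH), ?_⟩)))
        rw [vadd_eq_add, vadd_eq_add]; abel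
    · exact mem_insert_of_mem (add_mem_add hu hv)
  have hsup : insert γ (A + B) ⊆ insert (a₂ +ᵥ gα) A + insert (b₂ +ᵥ gβ) B :=
    insert_subset (add_mem_add (mem_insert_self _ _) (mem_insert_of_mem (hT₁B ht₁)))
      (add_subset_add (subset_insert _ _) (subset_insert _ _))
  have heq : insert (a₂ +ᵥ gα) A + insert (b₂ +ᵥ gβ) B = insert γ (A + B) :=
    Subset.antisymm hsub hsup
  -- "`C_{c₁} ∪ C_{c₂} = B_{b₁} + (A₁ ∪ A₂)`"
  have hC₁' : C₁ = {x₁ + t₁} := by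
    rw [← hC₁eq x₁ hx₁, hT₁eq, vadd_finset_singleton, vadd_eq_add]
  have hDeq : D = t₁ +ᵥ (A₁ ∪ A₂) := by
    rw [hDdec, hC₁', ← hC₂', hA₁eq, vadd_finset_union, vadd_finset_singleton, vadd_eq_add,
      add_comm t₁ x₁]
  -- the three sets are `H`-periodic up to one moved element
  have hHfper : IsPeriodicWith H Hf := fun h hh => vadd_addStab ((hA'H h).2 hh)
  have hx₁tC₁ : x₁ + t₁ ∈ C₁ := h11 (add_mem_add hx₁ ht₁)
  have hPA : IsPeriodicWith H (insert (a₂ +ᵥ gα) (A.erase x₁)) :=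
    isPeriodicWith_insert_erase (P := A') (S := A₂) (K := a₂ +ᵥ Hf) (by rw [hA, hA₁eq]) hper
      (hHfper.vadd a₂) (fun h => disjoint_left.1 hd₁ h hx₁) (fun h => disjoint_left.1 hd₁₂ hx₁ h)
      hA₂cos hαcos hαA₂ (by rw [card_vadd_finset]; exact hA₂card)
  have hPB : IsPeriodicWith H (insert (b₂ +ᵥ gβ) (B.erase t₁)) :=
    isPeriodicWith_insert_erase (P := B') (S := T₂) (K := b₂ +ᵥ Hf)
      (by rw [union_assoc, ← hT₁eq, ← hBdec, union_sdiff_of_subset (periodicPart_subset H B)])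
      hB'per (hHfper.vadd b₂) (mem_sdiff.1 (hT₁sub ht₁)).2 (fun h => disjoint_left.1 hT₁₂ ht₁ h)
      hT₂cos hβcos hβT₂ (by rw [card_vadd_finset]; exact hT₂card)
  have hPC : IsPeriodicWith H (insert γ ((A + B).erase (x₁ + t₁))) :=
    isPeriodicWith_insert_erase (P := C') (S := C₂) (K := c₂ +ᵥ Hf)
      (by rw [hABdec, hC₁', union_assoc]) hC'per (hHfper.vadd c₂)
      (mem_sdiff.1 (mem_filter.1 hx₁tC₁).1).2 (fun h => disjoint_left.1 hC₁₂ hx₁tC₁ h)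
      hC₂cos (mem_sdiff.1 hγmem).1 hγC₂ (by rw [card_vadd_finset]; omega)
  refine ⟨a₂ +ᵥ gα, b₂ +ᵥ gβ, x₁, t₁, hA₁eq, hT₁eq, hA₂card, hT₂card, hDeq, hHf3, hαA,
    by rw [vadd_eq_add, add_sub_cancel_left]; exact hgαH, hβB,
    by rw [vadd_eq_add, add_sub_cancel_left]; exact hgβH, hγAB, heq, hPA, hPB, hPC⟩

/-- **Lemma 5.6, Case 2 (display (34)) yields (17).**  In the situation of Lemma 5.6 (as in
`case_one_false`), suppose the second alternative of Proposition 5.5 holds with `ā = φ_H(a₁)`,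
`b̄ = φ_H(b₁)`: `B ∖ B′` meets exactly the two cosets of `b₁, b₂`, the partially filled cosets of `A + B`
are those of `a₁ + b₁` and `a₁ + b₂` (witnesses `w₁, w₂ ∉ A + B`), and `φ_H(a₂ + b₁) = φ_H(a₁ + b₂)`.
Then (17) holds: some `α, β` have `|(A ∪ {α}) + (B ∪ {β})| = |A ∪ {α}| + |B ∪ {β}| − 1`
("`|(A ∪ {α}) + (B ∪ {β})| = |A + B| + 1 = |A ∪ {α}| + |B ∪ {β}| − 1`, yielding (17)"): immediate
from the structure `case_two_structure` (`(A ∪ {α}) + (B ∪ {β}) = (A + B) ∪ {α + t₁}` with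
`α ∉ A`, `β ∉ B`, `α + t₁ ∉ A + B`) and `|A + B| = |A| + |B|`.  For `ā = φ_H(a₂)` apply it with `A₁`,
`A₂` interchanged. [cite: Grynkiewicz2009, Lemma 5.6 (proof, Case 2, display (34))] -/
theorem case_two_seventeen {A A' A₁ A₂ B : Finset G} {H : AddSubgroup G} {a₁ a₂ b₁ b₂ w₁ w₂ : G}
    (hA : A = A' ∪ A₁ ∪ A₂) (hA'ne : A'.Nonempty) (hH : H ≠ ⊥)
    (hA'H : ∀ g, g ∈ A'.addStab ↔ g ∈ H)
    (hA₁ : ∀ x ∈ A₁, x - a₁ ∈ H) (hA₂ : ∀ x ∈ A₂, x - a₂ ∈ H)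
    (hAB : #(A + B) = #A + #B) (haper : (A + B).addStab = {0})
    (hP3 : ∀ P : Finset G, A + B ⊆ P → P.addStab ≠ {0} → 3 ≤ #(P \ (A + B)))
    (hneA : IsNonExtendible A B) (hBne : B.Nonempty) (hAqp : ¬ IsQuasiPeriodic A)
    -- Case 2 data
    (hb₁ : b₁ ∈ B \ periodicPart H B) (hb₂ : b₂ ∈ B \ periodicPart H B) (hb12 : b₁ - b₂ ∉ H)
    (hB2 : ∀ b ∈ B \ periodicPart H B, b - b₁ ∈ H ∨ b - b₂ ∈ H)
    (hC2 : ∀ c ∈ (A + B) \ periodicPart H (A + B), c - (a₁ + b₁) ∈ H ∨ c - (a₁ + b₂) ∈ H)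
    (hw₁ : w₁ ∉ A + B) (hw₁c : w₁ - (a₁ + b₁) ∈ H)
    (hw₂ : w₂ ∉ A + B) (hw₂c : w₂ - (a₁ + b₂) ∈ H)
    (h21 : (a₂ + b₁) - (a₁ + b₂) ∈ H) :
    ∃ α β : G, #(insert α A + insert β B) + 1 = #(insert α A) + #(insert β B) := by
  obtain ⟨α, β, x₁, t₁, -, -, -, -, -, -, hαA, -, hβB, -, hγAB, heq, -, -, -⟩ :=
    case_two_structure hA hA'ne hH hA'H hA₁ hA₂ hAB haper hP3 hneA hBne hAqp hb₁ hb₂ hb12 hB2 hC2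
      hw₁ hw₁c hw₂ hw₂c h21
  refine ⟨α, β, ?_⟩
  rw [heq, card_insert_of_notMem hγAB, card_insert_of_notMem hαA, card_insert_of_notMem hβB, hAB]
  omega

/-! ### Lemma 5.6: the structure, the conclusion (17), and `d⊆(C, QP) = 1` -/

/-- **Grynkiewicz 2009, Lemma 5.6 — the structure behind both conclusions.**  Under the hypotheses of
Lemma 5.6 ("Let `A` and `B` be nonempty subsets of a finite abelian group `G` with `|A + B| = |A| + |B|`,
`0 ∈ A ∩ B`, `|A|, |B|, d⊆(A + B, P) ≥ 3`, `(A, B)` non-extendible, `⟨A⟩ = G` and `A` not quasi-periodic.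
If `A = A₀ ∪ A₂ ∪ A₁` with `A₀` a nonempty periodic subset with maximal period `H`, `A₁ ⊆ a₁ + H`, and
`A₂ ⊆ a₂ + H`, for some `a_i ∈ G` …"; `A₀` is `A'`, `H(A') = H ≠ 0` as `∀ g, g ∈ A'.addStab ↔ g ∈ H`,
`d⊆(A + B, P) ≥ 3` unfolded as "every periodic superset of `A + B` has at least three more elements",
`[DecidableEq (G ⧸ H)]` a hypothesis binder), only Case 2 of the printed proof can occur
(`prop55_cases_mod`, `case_one_false`) and it forces (`case_two_structure`): holes `α ∉ A`, `β ∉ B`,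
`γ ∉ A + B` and elements `x ∈ A`, `t ∈ B` with `(A ∪ {α}) + (B ∪ {β}) = (A + B) ∪ {γ}` and each of
`(A ∖ {x}) ∪ {α}`, `(B ∖ {t}) ∪ {β}`, `((A + B) ∖ {x + t}) ∪ {γ}` `H`-periodic, and `|H| ≥ 3` — i.e.
"`|A₁| = |B_{b₁}| = 1`, `|A₂| = |B_{b₂}| = |H| − 1`, and `C_{c₁} ∪ C_{c₂} = B_{b₁} + (A₁ ∪ A₂)`" in
whichever orientation Proposition 5.5 selects.  Both printed conclusions of Lemma 5.6 follow:
(17) (`seventeen_of_nearly_periodic`) and `d⊆(C, QP_H) = d⊆(C, QP) = 1` for the six sets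
(`subsetDist_eq_one_of_nearly_periodic`).  PROOF AS PRINTED (assembly over `G ⧸ H`, the symmetric
orientation by interchanging `A₁` and `A₂`). [cite: Grynkiewicz2009, Lemma 5.6 (proof)] -/
theorem nearly_periodic_structure [Fintype G] {A A' A₁ A₂ B : Finset G} {H : AddSubgroup G}
    [DecidableEq (G ⧸ H)] {a₁ a₂ : G}
    (hA : A = A' ∪ A₁ ∪ A₂) (hA'ne : A'.Nonempty) (hH : H ≠ ⊥)
    (hA'H : ∀ g, g ∈ A'.addStab ↔ g ∈ H)
    (hA₁ : ∀ x ∈ A₁, x - a₁ ∈ H) (hA₂ : ∀ x ∈ A₂, x - a₂ ∈ H)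
    (hA3 : 3 ≤ #A) (hB3 : 3 ≤ #B) (h0A : (0 : G) ∈ A) (h0B : (0 : G) ∈ B)
    (hAB : #(A + B) = #A + #B)
    (hP3 : ∀ P : Finset G, A + B ⊆ P → P.addStab ≠ {0} → 3 ≤ #(P \ (A + B)))
    (hneA : IsNonExtendible A B) (hneB : IsNonExtendible B A)
    (hgen : AddSubgroup.closure (A : Set G) = ⊤) (hAqp : ¬ IsQuasiPeriodic A) :
    ∃ α β γ x t : G, α ∉ A ∧ β ∉ B ∧ γ ∉ A + B ∧ x ∈ A ∧ t ∈ B ∧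
      insert α A + insert β B = insert γ (A + B) ∧
      IsPeriodicWith H (insert α (A.erase x)) ∧ IsPeriodicWith H (insert β (B.erase t)) ∧
      IsPeriodicWith H (insert γ ((A + B).erase (x + t))) ∧ 3 ≤ #A'.addStab := by
  have hBne : B.Nonempty := ⟨0, h0B⟩
  have hABne : (A + B).Nonempty := by rw [← card_pos, hAB]; have := hBne.card_pos; omega
  have hqe : ∀ x y : G, (x : G ⧸ H) = (y : G ⧸ H) ↔ x - y ∈ H := fun x y =>
    QuotientAddGroup.eq_iff_sub_mem
  obtain ⟨g₀, hg₀H, hg₀⟩ : ∃ g ∈ H, g ≠ (0 : G) := by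
    by_contra hne
    push Not at hne
    exact hH ((AddSubgroup.eq_bot_iff_forall _).2 hne)
  -- `A + B` is aperiodic and its complement has at least three elements
  have haper : (A + B).addStab = {0} := by
    by_contra hne
    have := hP3 (A + B) Subset.rfl hne
    rw [Finset.sdiff_self, card_empty] at this
    omega
  have hC3 : 3 ≤ #(A + B)ᶜ := by
    have hst : (univ : Finset G).addStab ≠ {0} := by
      intro heq
      have : g₀ ∈ (univ : Finset G).addStab := (mem_addStab univ_nonempty).2 vadd_finset_univ
      rw [heq, mem_singleton] at this
      exact hg₀ this
    have := hP3 univ (subset_univ _) hst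
    rwa [← compl_eq_univ_sdiff] at this
  obtain ⟨-, -, -, -, h12, -, -, -⟩ := parts_of_not_isQuasiPeriodic hA hA'ne hH hA'H hA₁ hA₂ hAqp
  have hA' : A = A' ∪ A₂ ∪ A₁ := by rw [hA, union_right_comm]
  -- witnesses of partially filled cosets
  have wit : ∀ {q : G ⧸ H} {x : G},
      q ∈ ((A + B) \ periodicPart H (A + B)).image ((↑) : G → G ⧸ H) → q = (x : G ⧸ H) →
      ∃ w, w ∉ A + B ∧ w - x ∈ H := by
    intro q x hq hqx
    obtain ⟨c, hc, rfl⟩ := mem_image.1 hq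
    obtain ⟨h, hh, hw⟩ := exists_add_notMem_of_mem_sdiff_periodicPart hc
    refine ⟨h + c, hw, ?_⟩
    have e : h + c - x = h + (c - x) := by abel
    rw [e]; exact H.add_mem hh ((hqe c x).1 hqx)
  have h55 := prop55_cases_mod hA hA'ne hH hA'H hA₁ hA₂ hA3 hB3 hC3 h0A h0B hAB haper hneA hneB
    hgen hAqp
  set 𝒜 : Finset (G ⧸ H) := {(a₁ : G ⧸ H), (a₂ : G ⧸ H)} with h𝒜
  set ℬ : Finset (G ⧸ H) := (B \ periodicPart H B).image ((↑) : G → G ⧸ H) with hℬ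
  set 𝒞 : Finset (G ⧸ H) := ((A + B) \ periodicPart H (A + B)).image ((↑) : G → G ⧸ H) with h𝒞
  rcases h55 with ⟨p, hp, p', hp', q, hq, q', hq', hpp, hqq, hpq, hpq', hne⟩ |
    ⟨-, hℬ2, -, p, hp, q, hq, hrow, hcol⟩
  · -- Case 1: impossible
    exfalso
    obtain ⟨b, hb, rfl⟩ := mem_image.1 hq
    obtain ⟨b', hb', rfl⟩ := mem_image.1 hq'
    have hbb : b - b' ∉ H := fun h => hqq ((hqe b b').2 h)
    rw [h𝒜, mem_insert, mem_singleton] at hp hp'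
    rcases hp with rfl | rfl <;> rcases hp' with rfl | rfl
    · exact hpp rfl
    · obtain ⟨w, hw, hwc⟩ := wit hpq (QuotientAddGroup.mk_add H a₁ b).symm
      obtain ⟨w', hw', hwc'⟩ := wit hpq' (QuotientAddGroup.mk_add H a₂ b').symm
      have hc : (a₁ + b) - (a₂ + b') ∉ H := fun h => hne (by
        rw [← QuotientAddGroup.mk_add, ← QuotientAddGroup.mk_add]; exact (hqe _ _).2 h)
      exact case_one_false hA hA'ne hH hA'H hA₁ hA₂ hAB haper hP3 hneA hBne hAqp hb hb' hbb
        hw hwc hw' hwc' hc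
    · obtain ⟨w, hw, hwc⟩ := wit hpq (QuotientAddGroup.mk_add H a₂ b).symm
      obtain ⟨w', hw', hwc'⟩ := wit hpq' (QuotientAddGroup.mk_add H a₁ b').symm
      have hc : (a₂ + b) - (a₁ + b') ∉ H := fun h => hne (by
        rw [← QuotientAddGroup.mk_add, ← QuotientAddGroup.mk_add]; exact (hqe _ _).2 h)
      exact case_one_false hA' hA'ne hH hA'H hA₂ hA₁ hAB haper hP3 hneA hBne hAqp hb hb' hbb
        hw hwc hw' hwc' hc
    · exact hpp rfl
  · -- Case 2
    obtain ⟨b₁, hb₁, rfl⟩ := mem_image.1 hq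
    -- the second coset of `B ∖ B'`
    obtain ⟨u, v, huv, hℬuv⟩ := card_eq_two.1 hℬ2
    have hb₁uv : (b₁ : G ⧸ H) = u ∨ (b₁ : G ⧸ H) = v := by
      have : (b₁ : G ⧸ H) ∈ ℬ := hq
      rw [hℬuv, mem_insert, mem_singleton] at this
      exact this
    obtain ⟨r, hrℬ, hrb₁⟩ : ∃ r ∈ ℬ, r ≠ (b₁ : G ⧸ H) := by
      rcases hb₁uv with h | h
      · exact ⟨v, by rw [hℬuv]; exact mem_insert_of_mem (mem_singleton_self v), by rw [h]; exact huv.symm⟩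
      · exact ⟨u, by rw [hℬuv]; exact mem_insert_self u _, by rw [h]; exact huv⟩
    obtain ⟨b₂, hb₂, rfl⟩ := mem_image.1 hrℬ
    have hb12 : b₁ - b₂ ∉ H := fun h => hrb₁ ((hqe b₂ b₁).2 (by
      have := H.neg_mem h; rwa [neg_sub] at this))
    have hℬeq : ℬ = {(b₁ : G ⧸ H), (b₂ : G ⧸ H)} := by
      symm
      refine eq_of_subset_of_card_le (insert_subset hq (singleton_subset_iff.2 hrℬ)) ?_
      rw [hℬ2, card_pair hrb₁.symm]
    have hB2 : ∀ b ∈ B \ periodicPart H B, b - b₁ ∈ H ∨ b - b₂ ∈ H := by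
      intro b hb
      have : (b : G ⧸ H) ∈ ℬ := mem_image_of_mem _ hb
      rw [hℬeq, mem_insert, mem_singleton] at this
      rcases this with h | h
      · exact Or.inl ((hqe b b₁).1 h)
      · exact Or.inr ((hqe b b₂).1 h)
    -- `𝒞 = p + {b̄₁, b̄₂}`
    have h𝒞eq : 𝒞 = {p + (b₁ : G ⧸ H), p + (b₂ : G ⧸ H)} := by
      rw [← hrow, hℬeq, vadd_finset_insert, vadd_finset_singleton, vadd_eq_add, vadd_eq_add]
    rw [h𝒜, mem_insert, mem_singleton] at hp
    -- generic finishing step, for either orientation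
    have finish : ∀ {A₁ A₂ : Finset G} {a₁ a₂ : G}, A = A' ∪ A₁ ∪ A₂ →
        (∀ x ∈ A₁, x - a₁ ∈ H) → (∀ x ∈ A₂, x - a₂ ∈ H) → a₁ - a₂ ∉ H →
        p = (a₁ : G ⧸ H) → (a₂ : G ⧸ H) ∈ 𝒜 →
        ∃ α β γ x t : G, α ∉ A ∧ β ∉ B ∧ γ ∉ A + B ∧ x ∈ A ∧ t ∈ B ∧
          insert α A + insert β B = insert γ (A + B) ∧
          IsPeriodicWith H (insert α (A.erase x)) ∧ IsPeriodicWith H (insert β (B.erase t)) ∧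
          IsPeriodicWith H (insert γ ((A + B).erase (x + t))) ∧ 3 ≤ #A'.addStab := by
      intro A₁ A₂ a₁ a₂ hA hA₁ hA₂ h12 hpa ha₂
      subst hpa
      have hC2 : ∀ c ∈ (A + B) \ periodicPart H (A + B),
          c - (a₁ + b₁) ∈ H ∨ c - (a₁ + b₂) ∈ H := by
        intro c hc
        have : (c : G ⧸ H) ∈ 𝒞 := mem_image_of_mem _ hc
        rw [h𝒞eq, mem_insert, mem_singleton, ← QuotientAddGroup.mk_add,
          ← QuotientAddGroup.mk_add] at this
        rcases this with h | h
        · exact Or.inl ((hqe _ _).1 h)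
        · exact Or.inr ((hqe _ _).1 h)
      have hin₁ : ((a₁ + b₁ : G) : G ⧸ H) ∈ 𝒞 := by
        rw [h𝒞eq, QuotientAddGroup.mk_add]; exact mem_insert_self _ _
      have hin₂ : ((a₁ + b₂ : G) : G ⧸ H) ∈ 𝒞 := by
        rw [h𝒞eq, QuotientAddGroup.mk_add]; exact mem_insert_of_mem (mem_singleton_self _)
      obtain ⟨w₁, hw₁, hw₁c⟩ := wit hin₁ rfl
      obtain ⟨w₂, hw₂, hw₂c⟩ := wit hin₂ rfl
      -- `φ(a₂ + b₁) = φ(a₁ + b₂)`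
      have h21 : (a₂ + b₁) - (a₁ + b₂) ∈ H := by
        have : (b₁ : G ⧸ H) + (a₂ : G ⧸ H) ∈ 𝒞 := by
          rw [← hcol]; exact mem_vadd_finset.2 ⟨_, ha₂, rfl⟩
        rw [h𝒞eq, mem_insert, mem_singleton, ← QuotientAddGroup.mk_add,
          ← QuotientAddGroup.mk_add, ← QuotientAddGroup.mk_add] at this
        rcases this with h | h
        · exfalso; apply h12
          have := (hqe _ _).1 h
          have e : a₁ - a₂ = -(b₁ + a₂ - (a₁ + b₁)) := by abel
          rw [e]; exact H.neg_mem this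
        · have := (hqe _ _).1 h
          have e : a₂ + b₁ - (a₁ + b₂) = b₁ + a₂ - (a₁ + b₂) := by abel
          rw [e]; exact this
      obtain ⟨α, β, x₁, t₁, hA₁eq, hT₁eq, -, -, -, hHf3, hαA, -, hβB, -, hγAB, heq, hPA, hPB, hPC⟩ :=
        case_two_structure hA hA'ne hH hA'H hA₁ hA₂ hAB haper hP3 hneA hBne hAqp hb₁ hb₂ hb12
          hB2 hC2 hw₁ hw₁c hw₂ hw₂c h21
      refine ⟨α, β, α + t₁, x₁, t₁, hαA, hβB, hγAB, ?_, ?_, heq, hPA, hPB, hPC, hHf3⟩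
      · rw [hA, hA₁eq]; simp
      · exact cosetTrace_subset H B b₁ (by rw [hT₁eq]; exact mem_singleton_self _)
    rcases hp with hp | hp
    · exact finish hA hA₁ hA₂ h12 hp (by rw [h𝒜]; exact mem_insert_of_mem (mem_singleton_self _))
    · exact finish hA' hA₂ hA₁ (fun h => h12 (by have := H.neg_mem h; rwa [neg_sub] at this)) hp
        (by rw [h𝒜]; exact mem_insert_self _ _)

/-- **Grynkiewicz 2009, Lemma 5.6 — the conclusion (17).**  "Let `A` and `B` be nonempty subsets of a
finite abelian group `G` with `|A + B| = |A| + |B|`, `0 ∈ A ∩ B`, `|A|, |B|, d⊆(A + B, P) ≥ 3`, `(A, B)`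
non-extendible, `⟨A⟩ = G` and `A` not quasi-periodic.  If `A = A₀ ∪ A₂ ∪ A₁` with `A₀` a nonempty periodic
subset with maximal period `H`, `A₁ ⊆ a₁ + H`, and `A₂ ⊆ a₂ + H`, for some `a_i ∈ G`, then … (17) holds",
(17) being "`|(A ∪ {α}) + (B ∪ {β})| = |A ∪ {α}| + |B ∪ {β}| − 1` for some `α, β`" (here `+ 1` on the left,
in `ℕ`).  `A₀` is `A'`, "maximal period `H`" is `H(A') = H` (`∀ g, g ∈ A'.addStab ↔ g ∈ H`), `H ≠ 0`;
`d⊆(A + B, P) ≥ 3` is carried unfolded as "every periodic superset of `A + B` has at least three more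
elements" (it implies `A + B` aperiodic and `|overline{A + B}| ≥ 3`, derived inside); `[DecidableEq (G ⧸ H)]`
is a hypothesis binder.  PROOF AS PRINTED ("`|(A ∪ {α}) + (B ∪ {β})| = |A + B| + 1 =
|A ∪ {α}| + |B ∪ {β}| − 1`, yielding (17)"), read off the structure `nearly_periodic_structure`
(assembled from `prop55_cases_mod`, `case_one_false`, `case_two_structure`).
[cite: Grynkiewicz2009, Lemma 5.6] -/
theorem seventeen_of_nearly_periodic [Fintype G] {A A' A₁ A₂ B : Finset G} {H : AddSubgroup G}
    [DecidableEq (G ⧸ H)] {a₁ a₂ : G}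
    (hA : A = A' ∪ A₁ ∪ A₂) (hA'ne : A'.Nonempty) (hH : H ≠ ⊥)
    (hA'H : ∀ g, g ∈ A'.addStab ↔ g ∈ H)
    (hA₁ : ∀ x ∈ A₁, x - a₁ ∈ H) (hA₂ : ∀ x ∈ A₂, x - a₂ ∈ H)
    (hA3 : 3 ≤ #A) (hB3 : 3 ≤ #B) (h0A : (0 : G) ∈ A) (h0B : (0 : G) ∈ B)
    (hAB : #(A + B) = #A + #B)
    (hP3 : ∀ P : Finset G, A + B ⊆ P → P.addStab ≠ {0} → 3 ≤ #(P \ (A + B)))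
    (hneA : IsNonExtendible A B) (hneB : IsNonExtendible B A)
    (hgen : AddSubgroup.closure (A : Set G) = ⊤) (hAqp : ¬ IsQuasiPeriodic A) :
    ∃ α β : G, #(insert α A + insert β B) + 1 = #(insert α A) + #(insert β B) := by
  obtain ⟨α, β, γ, x, t, hαA, hβB, hγAB, -, -, heq, -, -, -, -⟩ :=
    nearly_periodic_structure hA hA'ne hH hA'H hA₁ hA₂ hA3 hB3 h0A h0B hAB hP3 hneA hneB hgen hAqp
  refine ⟨α, β, ?_⟩
  rw [heq, card_insert_of_notMem hγAB, card_insert_of_notMem hαA, card_insert_of_notMem hβB, hAB]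
  omega

/-! ### Lemma 5.4 rolled out to the complements: none of the six sets is quasi-periodic -/

/-- `(g + s)ᶜ = g + sᶜ` in a finite group. [folklore] -/
private theorem compl_vadd_eq [Fintype G] (g : G) (s : Finset G) : (g +ᵥ s)ᶜ = g +ᵥ sᶜ := by
  ext x
  rw [mem_compl, ← neg_vadd_mem_iff, ← neg_vadd_mem_iff (a := g) (s := sᶜ), mem_compl]

/-- **Lemma 5.4 for `B̄`.**  Under the hypotheses of Lemma 5.4 with `G` finite ("`|A + B| = |A| + |B|`,
`0 ∈ A ∩ B`, `|A|, |B| ≥ 3`, `\overline{A + B} ≠ ∅`, `A + B` aperiodic, `(A, B)` non-extendible,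
`⟨A⟩ = G`, `A` not quasi-periodic"), the complement `B̄ = −A + \overline{A + B}` (Proposition 2.4) is
not quasi-periodic: the second part of Lemma 5.4 applied to the non-extendible pair
`(−A, −γ + \overline{A + B})`, `γ ∈ \overline{A + B}`, whose (aperiodic) sumset is `−γ + B̄` — the
sentence "it is sufficient for `A` to be a non-quasi-periodic, generating subset in order that this be
true (at least when `G` is finite) of every `C ∈ {A, B, A + B, B̄, Ā, \overline{A + B}}`" preceding
Lemma 5.4. [cite: Grynkiewicz2009, Lemma 5.4 (and the paragraph preceding it)] -/
theorem not_isQuasiPeriodic_compl_right [Fintype G] {A B : Finset G} (hA3 : 3 ≤ #A) (hB3 : 3 ≤ #B)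
    (hCne : (A + B)ᶜ.Nonempty) (h0A : (0 : G) ∈ A) (h0B : (0 : G) ∈ B)
    (hAB : #(A + B) = #A + #B) (haper : (A + B).addStab = {0})
    (hA : IsNonExtendible A B) (hB : IsNonExtendible B A)
    (hgen : AddSubgroup.closure (A : Set G) = ⊤) (hAqp : ¬ IsQuasiPeriodic A) :
    ¬ IsQuasiPeriodic Bᶜ := by
  classical
  set C := (A + B)ᶜ with hC
  obtain ⟨h5, hnA, hnC⟩ := isNonExtendible_pair_neg_compl hA hB
  obtain ⟨γ, hγ⟩ := hCne
  have hAne : A.Nonempty := ⟨0, h0A⟩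
  have hBne : B.Nonempty := ⟨0, h0B⟩
  have hBstab : B.addStab = {0} := by
    apply Subset.antisymm
    · rw [← haper]; exact subset_addStab_add_right hAne
    · rw [singleton_subset_iff]; exact hBne.zero_mem_addStab
  have hcardC : #C + #(A + B) = Fintype.card G := by
    have := card_le_univ (A + B)
    rw [hC, card_compl]; omega
  have hBcne : Bᶜ.Nonempty := by rw [← h5]; exact Nonempty.add hAne.neg ⟨γ, hγ⟩
  have hBcstab : Bᶜ.addStab = {0} := by rw [addStab_compl hBne hBcne, hBstab]
  have hsum : -A + ((-γ) +ᵥ C) = (-γ) +ᵥ Bᶜ := by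
    rw [add_comm (-A), vadd_add_assoc, add_comm C, h5]
  obtain ⟨h1, -, -⟩ := not_isQuasiPeriodic_add_and_compl (A := -A) (B := (-γ) +ᵥ C)
    (by rwa [card_neg]) (by rw [hsum, compl_vadd_eq, compl_compl, card_vadd_finset]; exact hB3)
    (by simpa using h0A) (mem_vadd_finset.2 ⟨γ, hγ, by simp⟩)
    (by rw [hsum, card_vadd_finset, card_neg, card_vadd_finset, card_compl]; omega)
    (by rw [hsum, addStab_vadd, hBcstab]) (hnA.vadd_right _) (hnC.vadd_left _)
    (by rw [coe_neg, AddSubgroup.closure_neg, hgen]) (by rwa [isQuasiPeriodic_neg_iff])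
  rw [hsum, isQuasiPeriodic_vadd_iff] at h1
  exact h1

/-- **None of the six sets is quasi-periodic.**  Under the hypotheses of Lemma 5.4 with `G` finite and
`|\overline{A + B}| ≥ 3`: `B`, `A + B`, `Ā`, `B̄`, `\overline{A + B}` are not quasi-periodic (and
`⟨B⟩ = G`) — Lemma 5.4 (both parts) together with its instance for the pair `(B, A)` (legitimate once
`B` is known to be a non-quasi-periodic generating set), as used in the proofs of Lemmas 5.6/5.7: "Thus in
view of Lemma 5.4, it follows that `d⊆(C, QP_H) = d⊆(C, QP) = 1` for all `C`"; "Since `A` is not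
quasi-periodic and since `⟨A⟩ = G`, it follows that `Ā` is not quasi-periodic. Likewise for `B̄`."
[cite: Grynkiewicz2009, Lemma 5.4 (and the paragraph preceding it)] -/
theorem not_isQuasiPeriodic_six [Fintype G] {A B : Finset G} (hA3 : 3 ≤ #A) (hB3 : 3 ≤ #B)
    (hC3 : 3 ≤ #(A + B)ᶜ) (h0A : (0 : G) ∈ A) (h0B : (0 : G) ∈ B)
    (hAB : #(A + B) = #A + #B) (haper : (A + B).addStab = {0})
    (hA : IsNonExtendible A B) (hB : IsNonExtendible B A)
    (hgen : AddSubgroup.closure (A : Set G) = ⊤) (hAqp : ¬ IsQuasiPeriodic A) :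
    ¬ IsQuasiPeriodic B ∧ ¬ IsQuasiPeriodic (A + B) ∧ ¬ IsQuasiPeriodic Aᶜ ∧
      ¬ IsQuasiPeriodic Bᶜ ∧ ¬ IsQuasiPeriodic (A + B)ᶜ ∧ AddSubgroup.closure (B : Set G) = ⊤ := by
  obtain ⟨hBqp, hgenB⟩ :=
    not_isQuasiPeriodic_and_closure_eq_top hA3 hB3 h0A h0B hAB haper hA hB hgen hAqp
  obtain ⟨hABqp, hABcqp, -⟩ :=
    not_isQuasiPeriodic_add_and_compl hA3 hC3 h0A h0B hAB haper hA hB hgen hAqp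
  have hCne : (A + B)ᶜ.Nonempty := card_pos.1 (by omega)
  have hBc := not_isQuasiPeriodic_compl_right hA3 hB3 hCne h0A h0B hAB haper hA hB hgen hAqp
  have hAc : ¬ IsQuasiPeriodic Aᶜ := by
    have hBA : #(B + A) = #B + #A := by rw [add_comm, hAB, add_comm]
    have haper' : (B + A).addStab = {0} := by rwa [add_comm]
    have hCne' : (B + A)ᶜ.Nonempty := by rwa [add_comm]
    exact not_isQuasiPeriodic_compl_right hB3 hA3 hCne' h0B h0A hBA haper' hB hA hgenB hBqp
  exact ⟨hBqp, hABqp, hAc, hBc, hABcqp, hgenB⟩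

/-! ### Lemma 5.6: the second conclusion, `d⊆(C, QP_H) = d⊆(C, QP) = 1` for the six sets -/

/-- For a set `X` that is not quasi-periodic but is `H`-periodic up to one moved element (`x ∈ X`,
`δ ∉ X`, `(X ∖ {x}) ∪ {δ}` `H`-periodic, `H ≠ 0`): `d⊆(X, QP_H) = d⊆(X, QP) = 1`, where `QP_H` is the
family of quasi-periodic sets with quasi-period `H` and `QP` that of quasi-periodic sets
("`d⊆(C, QP_H) = d⊆(C, QP) = 1`", proof of Lemma 5.6). [cite: Grynkiewicz2009, Lemma 5.6 (proof, Case 2)] -/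
theorem subsetDist_isQuasiPeriodic_eq_one {H : AddSubgroup G} (hH : H ≠ ⊥) {X : Finset G} {x δ : G}
    (hx : x ∈ X) (hδ : δ ∉ X) (hper : IsPeriodicWith H (insert δ (X.erase x)))
    (hX : ¬ IsQuasiPeriodic X) :
    subsetDist X {P | ∃ P₁ P₀, IsQuasiPeriodicDecomp H P P₁ P₀ ∧ P₁.Nonempty} = 1 ∧
      subsetDist X {P | IsQuasiPeriodic P} = 1 := by
  have hd := isQuasiPeriodicDecomp_insert_of_insert_erase hH hx hδ hper
  have hne : (insert δ (X.erase x)).Nonempty := ⟨δ, mem_insert_self δ _⟩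
  refine ⟨subsetDist_eq_one (fun ⟨P₁, P₀, h, hP₁⟩ => hX ⟨H, P₁, P₀, h, hP₁⟩) hδ ⟨_, _, hd, hne⟩,
    subsetDist_eq_one hX hδ ⟨H, _, _, hd, hne⟩⟩

/-- The complement version: for `X` `H`-periodic up to one moved element (`x ∈ X`, `δ ∉ X`,
`(X ∖ {x}) ∪ {δ}` `H`-periodic, `H ≠ 0`, `G` finite) with `X̄` not quasi-periodic:
`d⊆(X̄, QP_H) = d⊆(X̄, QP) = 1`. [cite: Grynkiewicz2009, Lemma 5.6 (proof, Case 2)] -/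
theorem subsetDist_isQuasiPeriodic_compl_eq_one [Fintype G] {H : AddSubgroup G} (hH : H ≠ ⊥)
    {X : Finset G} {x δ : G} (hx : x ∈ X) (hδ : δ ∉ X) (hper : IsPeriodicWith H (insert δ (X.erase x)))
    (hX : ¬ IsQuasiPeriodic Xᶜ) :
    subsetDist Xᶜ {P | ∃ P₁ P₀, IsQuasiPeriodicDecomp H P P₁ P₀ ∧ P₁.Nonempty} = 1 ∧
      subsetDist Xᶜ {P | IsQuasiPeriodic P} = 1 := by
  obtain ⟨hd, hxm⟩ := isQuasiPeriodicDecomp_insert_compl_of_insert_erase hH hx hδ hper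
  have hxc : x ∉ Xᶜ := fun h => mem_compl.1 h hx
  refine ⟨subsetDist_eq_one (fun ⟨P₁, P₀, h, hP₁⟩ => hX ⟨H, P₁, P₀, h, hP₁⟩) hxc ⟨_, _, hd, x, hxm⟩,
    subsetDist_eq_one hX hxc ⟨H, _, _, hd, x, hxm⟩⟩

/-- **Grynkiewicz 2009, Lemma 5.6 — the conclusion `d⊆(C, QP) = 1` for all
`C ∈ {A, B, A + B, Ā, B̄, \overline{A + B}}`.**  "Let `A` and `B` be nonempty subsets of a finite abelian
group `G` with `|A + B| = |A| + |B|`, `0 ∈ A ∩ B`, `|A|, |B|, d⊆(A + B, P) ≥ 3`, `(A, B)` non-extendible,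
`⟨A⟩ = G` and `A` not quasi-periodic.  If `A = A₀ ∪ A₂ ∪ A₁` with `A₀` a nonempty periodic subset with
maximal period `H`, `A₁ ⊆ a₁ + H`, and `A₂ ⊆ a₂ + H`, for some `a_i ∈ G`, then `d⊆(C, QP) = 1` for all
`C ∈ {A, B, A + B, Ā, B̄, \overline{A + B}}` …", together with the sharper statement reached in the
proof, "`d⊆(C, QP_H) = d⊆(C, QP) = 1`" (`QP_H` = the quasi-periodic sets with quasi-period `H`; `QP` =
`{P | IsQuasiPeriodic P}`; `d⊆` = `subsetDist` of `QuasiProgressions.lean`; hypotheses rendered as in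
`seventeen_of_nearly_periodic`).  PROOF AS PRINTED: "`≥ 1`" because none of the six sets is quasi-periodic
("in view of Lemma 5.4", `not_isQuasiPeriodic_six`), "`≤ 1`" from the structure of Case 2
(`nearly_periodic_structure`: each of `A, B, A + B` is `H`-periodic up to one moved element, so adding
the hole — resp., for the complements, the moved element — gives a quasi-periodic set with quasi-period
`H`). [cite: Grynkiewicz2009, Lemma 5.6] -/
theorem subsetDist_eq_one_of_nearly_periodic [Fintype G] {A A' A₁ A₂ B : Finset G}
    {H : AddSubgroup G} [DecidableEq (G ⧸ H)] {a₁ a₂ : G}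
    (hA : A = A' ∪ A₁ ∪ A₂) (hA'ne : A'.Nonempty) (hH : H ≠ ⊥)
    (hA'H : ∀ g, g ∈ A'.addStab ↔ g ∈ H)
    (hA₁ : ∀ x ∈ A₁, x - a₁ ∈ H) (hA₂ : ∀ x ∈ A₂, x - a₂ ∈ H)
    (hA3 : 3 ≤ #A) (hB3 : 3 ≤ #B) (h0A : (0 : G) ∈ A) (h0B : (0 : G) ∈ B)
    (hAB : #(A + B) = #A + #B)
    (hP3 : ∀ P : Finset G, A + B ⊆ P → P.addStab ≠ {0} → 3 ≤ #(P \ (A + B)))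
    (hneA : IsNonExtendible A B) (hneB : IsNonExtendible B A)
    (hgen : AddSubgroup.closure (A : Set G) = ⊤) (hAqp : ¬ IsQuasiPeriodic A) :
    ∀ C ∈ ({A, B, A + B, Aᶜ, Bᶜ, (A + B)ᶜ} : Finset (Finset G)),
      subsetDist C {P | ∃ P₁ P₀, IsQuasiPeriodicDecomp H P P₁ P₀ ∧ P₁.Nonempty} = 1 ∧
        subsetDist C {P | IsQuasiPeriodic P} = 1 := by
  have hBne : B.Nonempty := ⟨0, h0B⟩
  obtain ⟨g₀, hg₀H, hg₀⟩ : ∃ g ∈ H, g ≠ (0 : G) := by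
    by_contra hne
    push Not at hne
    exact hH ((AddSubgroup.eq_bot_iff_forall _).2 hne)
  -- `A + B` is aperiodic and its complement has at least three elements
  have haper : (A + B).addStab = {0} := by
    by_contra hne
    have := hP3 (A + B) Subset.rfl hne
    rw [Finset.sdiff_self, card_empty] at this
    omega
  have hC3 : 3 ≤ #(A + B)ᶜ := by
    have hst : (univ : Finset G).addStab ≠ {0} := by
      intro heq
      have : g₀ ∈ (univ : Finset G).addStab := (mem_addStab univ_nonempty).2 vadd_finset_univ
      rw [heq, mem_singleton] at this
      exact hg₀ this
    have := hP3 univ (subset_univ _) hst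
    rwa [← compl_eq_univ_sdiff] at this
  obtain ⟨hBqp, hABqp, hAcqp, hBcqp, hABcqp, -⟩ :=
    not_isQuasiPeriodic_six hA3 hB3 hC3 h0A h0B hAB haper hneA hneB hgen hAqp
  obtain ⟨α, β, γ, x, t, hαA, hβB, hγAB, hxA, htB, -, hPA, hPB, hPC, -⟩ :=
    nearly_periodic_structure hA hA'ne hH hA'H hA₁ hA₂ hA3 hB3 h0A h0B hAB hP3 hneA hneB hgen hAqp
  have hxt : x + t ∈ A + B := add_mem_add hxA htB
  intro C hC
  simp only [mem_insert, mem_singleton] at hC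
  rcases hC with rfl | rfl | rfl | rfl | rfl | rfl
  · exact subsetDist_isQuasiPeriodic_eq_one hH hxA hαA hPA hAqp
  · exact subsetDist_isQuasiPeriodic_eq_one hH htB hβB hPB hBqp
  · exact subsetDist_isQuasiPeriodic_eq_one hH hxt hγAB hPC hABqp
  · exact subsetDist_isQuasiPeriodic_compl_eq_one hH hxA hαA hPA hAcqp
  · exact subsetDist_isQuasiPeriodic_compl_eq_one hH htB hβB hPB hBcqp
  · exact subsetDist_isQuasiPeriodic_compl_eq_one hH hxt hγAB hPC hABcqp

end Grynkiewicz2009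

end Literature.Combinatorics.Additive
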